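import Literature.AlgebraicGeometry.Resolution.DiscCutout
import Literature.AlgebraicGeometry.Resolution.DiscCutoutForms
import HarnessLib

/-!
# The `L₁`-rational cut-out of the disc: the whole package of `RelCurveChart` fields

Topic: `Literature/AlgebraicGeometry/Resolution`. M. Temkin, *Inseparable local uniformization*,
J. Algebra 373 (2013) = arXiv:0804.1554v3, proof of Thm. 3.3.1, Step 3. Joining
`DiscCutout.lean` (valuative properties) and `DiscCutoutForms.lean` (polynomial forms): from the
conjugate-disc data of an `m`-rational disc `|X − a| ≤ |c|` through `x` — the `k`-conjugates
`aᵢ ∈ M` of `a`, the constants `m ≤ M` with their valuation-theoretic properties, the exponent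
`e` and an `m`-rational `d` with `|d| = |cNorm|` (value-torsion) — the cut-out function
`g = Q(x)^e/d` and the sheet cutter `b = ∏_{far}(x − aᵢ)/(a − aᵢ)` satisfy ALL the cut-out
fields of the chart datum `RelCurveChart` (`RelativeCurveChartSetup.lean`):
`hgL` (`|g| ≤ 1`), `hvb`, `hgLpoly`, `hbpoly`, `hbfrac`, `hbmemL`, `hbcutL`.

* `valuation_prod_sub_le` — `|Q(x)| ≤ |c|^{#near} ∏_{far} |aᵢ − a|` on the disc — PROVED;
* `cNorm_mem`, `cNorm_ne_zero` — bookkeeping — PROVED;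
* `cutout_package` — **the package** — PROVED.

Everything is [folklore]; no named facts.

## Sources

* M. Temkin, arXiv:0804.1554v3, proof of Thm. 3.3.1, Step 3 (p. 45).
-/

noncomputable section

open scoped BigOperators
open Polynomial

namespace Literature.AlgebraicGeometry.Resolution

namespace ConjugateDiscs

universe u

variable {Ω : Type u} [Field Ω] (V : ValuationSubring Ω)
variable {I : Type u} [Fintype I] (a : I → Ω) (i₀ : I) (c : Ω)

/-- **`|Q(x)| ≤ |c|^{#near} · ∏_{far} |aᵢ − a|`** for `x` in the disc `|x − a| ≤ |c|`. [folklore] -/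
theorem valuation_prod_sub_le {x : Ω} (hΔ : V.valuation (x - a i₀) ≤ V.valuation c) :
    V.valuation (∏ i, (x - a i)) ≤
      V.valuation c ^ (near V.valuation a i₀ (V.valuation c)).card *
        ∏ i ∈ far V.valuation a i₀ (V.valuation c), V.valuation (a i - a i₀) := by
  rw [map_prod, prod_univ_eq_near_mul_far a i₀ V.valuation (V.valuation c)]
  refine mul_le_mul' ?_ (le_of_eq (Finset.prod_congr rfl fun i hi => ?_))
  · rw [← Finset.prod_const]
    refine Finset.prod_le_prod' fun i hi => ?_
    exact (valuation_sub_le_max (w := V.valuation) (a := a) (i₀ := i₀) (x := x) i).trans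
      (max_le hΔ (mem_near.mp hi))
  · exact valuation_sub_far_eq_of_lt x (lt_of_le_of_lt hΔ (mem_far.mp hi))

/-- The value of `cNorm`. [folklore] -/
theorem valuation_cNorm (e : ℕ) : V.valuation (cNorm V a i₀ c e) =
    (V.valuation c ^ (near V.valuation a i₀ (V.valuation c)).card *
      ∏ i ∈ far V.valuation a i₀ (V.valuation c), V.valuation (a i - a i₀)) ^ e := by
  simp only [cNorm, map_pow, map_mul, map_prod]

/-- `cNorm ≠ 0`. [folklore] -/
theorem cNorm_ne_zero (hc0 : c ≠ 0) (e : ℕ) : cNorm V a i₀ c e ≠ 0 := by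
  unfold cNorm
  refine pow_ne_zero _ (mul_ne_zero (pow_ne_zero _ hc0) (Finset.prod_ne_zero_iff.mpr fun i hi h0 => ?_))
  exact far_ne_i₀ hi (by rw [← neg_sub, h0, neg_zero])

/-- `cNorm ∈ m` when `c, a ∈ m` and the far product is `m`-rational. [folklore] -/
theorem cNorm_mem (m : Subfield Ω) (ha₀m : a i₀ ∈ m) (hcm : c ∈ m)
    (hFm : ∀ j, (∏ i ∈ far V.valuation a i₀ (V.valuation c), (X - C (a i))).coeff j ∈ m) (e : ℕ) :
    cNorm V a i₀ c e ∈ m := by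
  unfold cNorm
  rw [prod_far_sub_eq]
  refine m.pow_mem (m.mul_mem (m.pow_mem hcm _) (m.mul_mem (m.pow_mem (m.neg_mem m.one_mem) _) ?_)) _
  have : ∏ i ∈ far V.valuation a i₀ (V.valuation c), (a i₀ - a i) =
      (∏ i ∈ far V.valuation a i₀ (V.valuation c), (X - C (a i))).eval (a i₀) := by
    rw [eval_prod]
    exact Finset.prod_congr rfl fun i _ => by rw [eval_sub, eval_X, eval_C]
  rw [this]
  exact eval_mem_subfield_of_coeff_mem hFm ha₀m

/-- **The cut-out package.** See the module docstring. [folklore] -/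
theorem cutout_package (M m : Subfield Ω) (hmM : m ≤ M) (ha : ∀ i, a i ∈ M) (hcM : c ∈ M)
    (hc0 : c ≠ 0) (hcV : c ∈ V) (ha₀m : a i₀ ∈ m) (ha₀V : a i₀ ∈ V) (hcm : c ∈ m)
    (hArch : ∀ μ ∈ M, μ ∉ V → ∀ ν ∈ M, ∃ n : ℕ, ν * μ⁻¹ ^ n ∈ V)
    (hMint : ∀ W : ValuationSubring Ω, (∀ μ ∈ m, μ ∈ W) → ∀ μ ∈ M, μ ∈ W)
    (hmax : ∀ W : ValuationSubring Ω, (∀ μ ∈ m, μ ∈ V → μ ∈ W) →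
      (∀ μ ∈ m, μ ∈ W) ∨ (∀ μ ∈ m, μ ∈ W ↔ μ ∈ V))
    (hGal : ∀ W : ValuationSubring Ω, (∀ μ ∈ m, μ ∈ W ↔ μ ∈ V) → ∀ μ ∈ M, μ ∈ W ↔ μ ∈ V)
    (hQm : ∀ j, (∏ i, (X - C (a i))).coeff j ∈ m)
    (hFm : ∀ j, (∏ i ∈ far V.valuation a i₀ (V.valuation c), (X - C (a i))).coeff j ∈ m)
    {x : Ω} (hxV : x ∈ V) (hΔ : V.valuation (x - a i₀) ≤ V.valuation c)
    {e : ℕ} (he : e ≠ 0) {d : Ω} (hdm : d ∈ m) (hd0 : d ≠ 0)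
    (hd : V.valuation d = V.valuation (cNorm V a i₀ c e)) :
    (∏ i, (x - a i)) ^ e / d ∈ V ∧
    V.valuation (conjProd V.valuation a i₀ (V.valuation c) x) = 1 ∧
    (∃ q : Polynomial Ω, (∀ j, q.coeff j ∈ m ∧ q.coeff j ∈ V) ∧
      (∏ i, (x - a i)) ^ e / d = q.eval ((x - a i₀) / c)) ∧
    (∃ q : Polynomial Ω, (∀ j, q.coeff j ∈ m ∧ q.coeff j ∈ V) ∧
      conjProd V.valuation a i₀ (V.valuation c) x = q.eval ((x - a i₀) / c)) ∧
    (∃ u ∈ m, u ∈ V ∧ u ≠ 0 ∧ ∃ q : Polynomial Ω, (∀ j, q.coeff j ∈ m ∧ q.coeff j ∈ V) ∧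
      u * conjProd V.valuation a i₀ (V.valuation c) x = q.eval x) ∧
    (∀ W : ValuationSubring Ω, x ∈ W → (∏ i, (x - a i)) ^ e / d ∈ W →
      (∀ μ ∈ M, μ ∈ W ↔ μ ∈ V) → conjProd V.valuation a i₀ (V.valuation c) x ∈ W) ∧
    (∀ W : ValuationSubring Ω, x ∈ W → (∏ i, (x - a i)) ^ e / d ∈ W →
      (∀ μ ∈ M, μ ∈ W ↔ μ ∈ V) → W.valuation (conjProd V.valuation a i₀ (V.valuation c) x) = 1 →
      W.valuation (x - a i₀) ≤ W.valuation c) := by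
  set Q : Ω := ∏ i, (x - a i) with hQ
  set g : Ω := Q ^ e / d with hg
  set cN : Ω := cNorm V a i₀ c e with hcN
  have hcN0 : cN ≠ 0 := cNorm_ne_zero V a i₀ c hc0 e
  have hcNm : cN ∈ m := cNorm_mem V a i₀ c m ha₀m hcm hFm e
  set ν : Ω := d / cN with hν
  have hνm : ν ∈ m := m.div_mem hdm hcNm
  have hν0 : ν ≠ 0 := div_ne_zero hd0 hcN0
  have hvν : V.valuation ν = 1 := by
    rw [hν, map_div₀, hd, hcN, div_self ((Valuation.ne_zero_iff _).mpr hcN0)]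
  have hνV : ν ∈ V := (V.valuation_le_one_iff _).mp hvν.le
  have hνinv : ν⁻¹ ∈ V := (V.valuation_le_one_iff _).mp (by rw [map_inv₀, hvν, inv_one])
  have hνM : ν ∈ M := hmM hνm
  have hgQ : g * ν * cNorm V a i₀ c e = Q ^ e := by
    rw [hg, hν, ← hcN]
    field_simp
  -- `|g| ≤ 1`
  have hgV : g ∈ V := by
    rw [← V.valuation_le_one_iff, hg, map_div₀, hd, map_pow,
      div_le_one₀ ((Valuation.pos_iff _).mpr hcN0), hcN, valuation_cNorm]
    exact pow_le_pow_left' (valuation_prod_sub_le V a i₀ c hΔ) e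
  -- the valuative package
  have hval := fun (W : ValuationSubring Ω) (hxW : x ∈ W) (hgW : g ∈ W)
      (hWM : ∀ μ ∈ M, μ ∈ W ↔ μ ∈ V) =>
    sheetCutter_mem_and V M m a i₀ c hmM ha hcM hc0 hcV ha₀m ha₀V hcm hArch hMint hmax hGal hνM hνV
      he hgQ hFm hΔ W hxW hgW hWM
  have hvb : V.valuation (conjProd V.valuation a i₀ (V.valuation c) x) = 1 :=
    (hval V hxV hgV fun _ _ => Iff.rfl).2.1
  -- the polynomial forms
  have hbpoly : ∃ q : Polynomial Ω, (∀ j, q.coeff j ∈ m ∧ q.coeff j ∈ V) ∧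
      conjProd V.valuation a i₀ (V.valuation c) x = q.eval ((x - a i₀) / c) :=
    ⟨cutterPoly V a i₀ c, fun j => ⟨cutterPoly_coeff_mem m ha₀m hcm hFm j, cutterPoly_coeff_mem_V j⟩,
      conjProd_eq_eval_cutterPoly hc0 x⟩
  have hgpoly : ∃ q : Polynomial Ω, (∀ j, q.coeff j ∈ m ∧ q.coeff j ∈ V) ∧
      g = q.eval ((x - a i₀) / c) :=
    ⟨cutoutPoly V a i₀ c ν e, fun j => ⟨cutoutPoly_coeff_mem hc0 m ha₀m hcm hQm hFm hνm hν0 e j,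
      cutoutPoly_coeff_mem_V hc0 hνinv e j⟩, eq_eval_cutoutPoly hc0 hν0 hgQ⟩
  have hbfrac : ∃ u ∈ m, u ∈ V ∧ u ≠ 0 ∧ ∃ q : Polynomial Ω, (∀ j, q.coeff j ∈ m ∧ q.coeff j ∈ V) ∧
      u * conjProd V.valuation a i₀ (V.valuation c) x = q.eval x := by
    obtain ⟨q₀, hq₀, hbq₀⟩ := hbpoly
    obtain ⟨q, hq, hcq⟩ := exists_mul_eq_eval_of_coeff_mem c (m.toSubring ⊓ V.toSubring)
      (fun j => Subring.mem_inf.mpr (hq₀ j)) (Subring.mem_inf.mpr ⟨ha₀m, ha₀V⟩)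
      (Subring.mem_inf.mpr ⟨hcm, hcV⟩) hc0 x
    refine ⟨c ^ q₀.natDegree, m.pow_mem hcm _, V.pow_mem hcV _, pow_ne_zero _ hc0, q,
      fun j => Subring.mem_inf.mp (hq j), ?_⟩
    rw [hbq₀, hcq]
  exact ⟨hgV, hvb, hgpoly, hbpoly, hbfrac, fun W hxW hgW hWM => (hval W hxW hgW hWM).1,
    fun W hxW hgW hWM hWb => sheetCutter_cut V M m a i₀ c hmM ha hcM hc0 hcV ha₀m ha₀V hcm hArch
      hMint hmax hGal hνM hνV he hgQ hFm hΔ W hxW hgW hWM hWb⟩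

end ConjugateDiscs

end Literature.AlgebraicGeometry.Resolution

end
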